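import Summits.BirchSwinnertonDyer.BirchSwinnertonDyer.Theorems.ManinLocalTwoThreeIstarZeroNeronScalarParity
import Summits.BirchSwinnertonDyer.BirchSwinnertonDyer.Theorems.ManinLocalTwoThreeVeluThreeIsogenous
import Literature.NumberTheory.EllipticCurves.PastenHeightBoundsLemma68Proofs
import HarnessLib

/-!
# Additive reduction at `3` transfers along isogenies; E-an-109 for rational `3`-lines on tame `I₀*` made UNCONDITIONAL, and the
# tame Néron-scalar table at `3` (E-an-107 / 108 / 109) in one statement

Summit `BirchSwinnertonDyer`, route `ManinLocalTwoThree` (cell bsd-f2-manin), deciding crux C3 `ManinPrimeToThreeAtNine`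
(stmt-BirchSwinnertonDyer-22968).  p654090 (`…IstarZeroNeronScalarParity`) proved the even branch of E-an-109 granted conductor invariance
(`exists_isNewformOf`).  Conductor invariance is not needed: ADDITIVITY at `3` transfers along a `ℚ`-isogeny unconditionally (good
reduction transfers by *AEC* VII.7.2, tree `Isogeny.hasGoodReductionAt_of_hasGoodReductionAt`; multiplicative reduction by the tree's
`Isogeny.hasMultiplicativeReductionAt_of_hasMultiplicativeReductionAt`; trichotomy), and an ADDITIVE curve at `3` has `ord₃ Δ_min ≥ 3`
(type `II` is wild with `ord₃ Δ ≥ 3`, p650740; every other additive type has `m ≥ 2`) and, if `ord₃ Δ_min = 18`, is of type `I₁₂*`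
(`f₃ ≤ 5`, tree `conductorExponent_le_five…`, so `m ≥ 14`; `Iₙ*` is tame, `f = 2`; hence `n = 12`, `ord₃ j = −12`, p651737).

* `hasAdditiveReductionAt_placeOf_three_of_isIsogenous` — additivity at `3` is a `ℚ`-isogeny invariant.
* `three_le_padicValInt_minimalDiscriminantInt_of_hasAdditiveReductionAt_three`, `padicValRat_three_j_of_additive_of_eq_eighteen`.
* `IstarZero_padicValRat_D₀_eq_zero_or_three` — **E-an-109 core, UNCONDITIONAL**: on tame `I₀*`, every rational `3`-line has `ord₃ D₀ ∈ {0, 3}`.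
* `IstarZero_velu_three_of_even'` — the even branch WITHOUT modularity: `ord₃ D₀` even ⟹ `ord₃ D₀ = 0`, an isogenous `u = 3` carrier, no
  isogenous `u = 1` carrier.
* `tameThree_neronScalar_table` — `9 ∥ N`, `ord₃ j ≥ 0`, `q` a rational `3`-line: the three rows `III` / `III*` / `I₀*` (E-an-107/108/109),
  all unconditional.

HONEST FRAMING: local structure; C3, Manin's conjecture and BSD are not proved.  No definitions, no named facts, no sorry.
References: [SilvermanAEC2009] Cor. VII.7.2; [SilvermanATAEC1994] IV.9.4 Table 4.1, IV.10.4; [BrumerKramer1994] Thm. 6.2;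
[DokchitserDokchitser2015LocalInvariants] Table 1; HOME/MEMO-an.md §66–§68.
-/

set_option linter.dupNamespace false
set_option autoImplicit false

noncomputable section

open scoped Classical

open WeierstrassCurve Polynomial CongruenceSubgroup IsDedekindDomain NumberField Rat.HeightOneSpectrum
  Literature.NumberTheory.DiophantineGeometry
  Literature.NumberTheory.EllipticCurves Literature.NumberTheory.EllipticCurves.ModularForms
  Summit.BirchSwinnertonDyer.Rank1Residual.Additive

namespace Summit.BirchSwinnertonDyer.BirchSwinnertonDyer.Theorems.ManinLocalTwoThree

/-! ### §1 Additivity at `3` along isogenies -/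

/-- **Additive reduction at `3` is a `ℚ`-isogeny invariant** (trichotomy + the transfers of good and multiplicative reduction).
[cite: SilvermanAEC2009, Cor. VII.7.2] -/
theorem hasAdditiveReductionAt_placeOf_three_of_isIsogenous {W W' : WeierstrassCurve ℚ} [W.IsElliptic] [W'.IsElliptic]
    (ha : W.HasAdditiveReductionAt (placeOf 3)) (h : IsIsogenous W W') : W'.HasAdditiveReductionAt (placeOf 3) := by
  set v' : HeightOneSpectrum (𝓞 ℚ) := (primesEquiv (R := 𝓞 ℚ)).symm ⟨3, Nat.prime_three⟩ with hv'
  have haW : W.HasAdditiveReductionAt v' := (W.hasAdditiveReductionAt_int_iff_ringOfIntegers ⟨3, Nat.prime_three⟩).mp ha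
  obtain ⟨ψ⟩ := h.symm_of_charZero
  obtain ⟨φ⟩ := h
  rcases hasGoodReductionAt_or_hasMultiplicativeReductionAt_or_hasAdditiveReductionAt v' W' with hg | hm | ha'
  · exact absurd (φ.hasGoodReductionAt_of_hasGoodReductionAt hg) haW.not_hasGoodReductionAt
  · exact absurd (ψ.hasMultiplicativeReductionAt_of_hasMultiplicativeReductionAt hm) haW.not_hasMultiplicativeReductionAt
  · exact (W'.hasAdditiveReductionAt_int_iff_ringOfIntegers ⟨3, Nat.prime_three⟩).mpr ha'

/-- `9 ∣ N(W)` ⟹ additive at the place `placeOf 3` of `ℤ`. [cite: SilvermanAEC2009, C.16] -/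
theorem hasAdditiveReductionAt_placeOf_three_of_nine_dvd (W : WeierstrassCurve ℚ) [W.IsElliptic] (h9 : 3 ^ 2 ∣ W.conductorNorm ℤ) :
    W.HasAdditiveReductionAt (placeOf 3) :=
  (W.hasAdditiveReductionAt_int_iff_ringOfIntegers ⟨3, Nat.prime_three⟩).mpr (hasAdditiveReductionAt_three_of_nine_dvd_conductorNorm W h9)

/-! ### §2 What an additive curve at `3` looks like: `ord₃ Δ_min ≥ 3`; `ord₃ Δ_min = 18` ⟹ `I₁₂*`, `ord₃ j = −12` -/

/-- **An additive curve at `3` has `ord₃ Δ_min ≥ 3`** (`f₃ ≥ 2`, Ogg: `ord₃ Δ_min = f + m − 1 ≥ m + 1`; `m = 1` is type `II`, wild with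
`ord₃ Δ ≥ 3`, p650740). [cite: SilvermanATAEC1994, IV.9.4 Table 4.1] -/
theorem three_le_padicValInt_minimalDiscriminantInt_of_hasAdditiveReductionAt_three (W : WeierstrassCurve ℚ) [W.IsElliptic]
    [W.IsGloballyMinimal] (ha : W.HasAdditiveReductionAt (placeOf 3)) : 3 ≤ padicValInt 3 W.minimalDiscriminantInt := by
  haveI : PerfectField (IsLocalRing.ResidueField ((placeOf 3).adicCompletionIntegers ℚ)) := PerfectField.ofFinite
  have hf : 2 ≤ W.conductorExponent (placeOf 3) := (W.two_le_conductorExponent_iff_holds (placeOf 3)).mpr ha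
  have hadd : (W.kodairaSymbolAt (placeOf 3)).IsAdditive := (isAdditive_kodairaSymbolAt_iff_holds (placeOf 3) W).mpr ha
  rw [← ordMinimalDiscriminant_placeOf_eq W 3]
  have hII : W.kodairaSymbolAt (placeOf 3) = .II → 3 ≤ W.conductorExponent (placeOf 3) := fun h ↦
    three_le_conductorExponent_of_kodairaSymbolAt_of_three_mem (placeOf 3) W
      three_mem_maximalIdeal_adicCompletionIntegers_placeOf_three (Or.inl h)
  unfold conductorExponent numComponentsAt at hf hII
  generalize hT : W.kodairaSymbolAt (placeOf 3) = T at hadd hf hII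
  cases T with
  | I n => exact absurd hadd (KodairaSymbol.not_isAdditive_I n)
  | II => have := hII rfl; rw [show KodairaSymbol.numComponents .II = 1 from rfl] at this; omega
  | III => rw [show KodairaSymbol.numComponents .III = 2 from rfl] at hf; omega
  | IV => rw [show KodairaSymbol.numComponents .IV = 3 from rfl] at hf; omega
  | Istar n => rw [KodairaSymbol.numComponents_Istar] at hf; omega
  | IVstar => rw [show KodairaSymbol.numComponents .IVstar = 7 from rfl] at hf; omega
  | IIIstar => rw [show KodairaSymbol.numComponents .IIIstar = 8 from rfl] at hf; omega
  | IIstar => rw [show KodairaSymbol.numComponents .IIstar = 9 from rfl] at hf; omega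

/-- **An additive curve at `3` with `ord₃ Δ_min = 18` is of type `I₁₂*`, so `ord₃ j = −12`** (`f₃ ≤ 5` ⟹ `m ≥ 14` ⟹ `Iₙ*`; `Iₙ*` is tame, `f = 2`,
`n = 12`). [cite: SilvermanATAEC1994, IV.10.4 and Table 4.1] [cite: BrumerKramer1994, Thm. 6.2] -/
theorem padicValRat_three_j_of_additive_of_eq_eighteen (W : WeierstrassCurve ℚ) [W.IsElliptic] [W.IsGloballyMinimal]
    (ha : W.HasAdditiveReductionAt (placeOf 3)) (hΔ : padicValInt 3 W.minimalDiscriminantInt = 18) : padicValRat 3 W.j = -12 := by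
  haveI : PerfectField (IsLocalRing.ResidueField ((placeOf 3).adicCompletionIntegers ℚ)) := PerfectField.ofFinite
  have hgen : natGenerator (placeOf 3) = 3 :=
    congrArg Subtype.val ((primesEquiv (R := ℤ)).apply_symm_apply ⟨3, Nat.prime_three⟩)
  have hf5 : W.conductorExponent (placeOf 3) ≤ 5 := W.conductorExponent_le_five_of_natGenerator_eq_three_holds (placeOf 3) hgen
  have hadd : (W.kodairaSymbolAt (placeOf 3)).IsAdditive := (isAdditive_kodairaSymbolAt_iff_holds (placeOf 3) W).mpr ha
  have hδ : W.ordMinimalDiscriminant (placeOf 3) = 18 := by rw [ordMinimalDiscriminant_placeOf_eq W 3, hΔ]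
  have h2 : ringChar (ℤ ⧸ (placeOf 3).asIdeal) ≠ 2 := by rw [ringChar_int_quot_placeOf 3]; decide
  -- the type is `Iₙ*` with `n + 5 = m ≥ 14`
  have hIstar : ∃ n, W.kodairaSymbolAt (placeOf 3) = .Istar (n + 1) := by
    have hf := hf5
    unfold conductorExponent numComponentsAt at hf
    rw [hδ] at hf
    generalize hT : W.kodairaSymbolAt (placeOf 3) = T at hadd hf
    cases T with
    | I n => exact absurd hadd (KodairaSymbol.not_isAdditive_I n)
    | II => rw [show KodairaSymbol.numComponents .II = 1 from rfl] at hf; omega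
    | III => rw [show KodairaSymbol.numComponents .III = 2 from rfl] at hf; omega
    | IV => rw [show KodairaSymbol.numComponents .IV = 3 from rfl] at hf; omega
    | Istar n =>
      cases n with
      | zero => rw [KodairaSymbol.numComponents_Istar] at hf; omega
      | succ n => exact ⟨n, rfl⟩
    | IVstar => rw [show KodairaSymbol.numComponents .IVstar = 7 from rfl] at hf; omega
    | IIIstar => rw [show KodairaSymbol.numComponents .IIIstar = 8 from rfl] at hf; omega
    | IIstar => rw [show KodairaSymbol.numComponents .IIstar = 9 from rfl] at hf; omega
  obtain ⟨n, hn⟩ := hIstar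
  -- `Iₙ*` is tame: `f = 2`, so `n + 1 + 6 = 18`
  have hf2 : W.conductorExponent (placeOf 3) = 2 :=
    W.conductorExponent_eq_two_of_kodairaSymbolAt (placeOf 3) h2 (Or.inr (Or.inr ⟨n + 1, hn⟩))
  have hn11 : n = 11 := by
    unfold conductorExponent numComponentsAt at hf2
    rw [hδ, hn, KodairaSymbol.numComponents_Istar] at hf2
    omega
  subst hn11
  have := padicValRat_three_j_eq_neg_of_kodairaSymbolAt_Istar_succ W hn
  rw [this]; norm_num

/-! ### §3 E-an-109 on tame `I₀*`, unconditional -/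

/-- **E-an-109 core (UNCONDITIONAL): on tame `I₀*` every rational `3`-line has `ord₃ D₀ ∈ {0, 3}`.**  (`ord₃ D₀ ≥ 3` with the isogenous
carrier `(W′, k)`: `k = ±3` is impossible, and `k = ±1` gives `ord₃ Δ_min(W′) = 18 − 4·ord₃ D₀ ≥ 3` by additivity of `W′`.)
[cite: SilvermanATAEC1994, IV.9.4 Table 4.1] [cite: DokchitserDokchitser2015LocalInvariants, Table 1] -/
theorem IstarZero_padicValRat_D₀_eq_zero_or_three (W : WeierstrassCurve ℚ) [W.IsElliptic] [W.IsGloballyMinimal]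
    (h9 : 3 ^ 2 ∣ W.conductorNorm ℤ) (h27 : ¬ 3 ^ 3 ∣ W.conductorNorm ℤ) (hΔ6 : padicValInt 3 W.minimalDiscriminantInt = 6)
    (q : ℚ) (hq : W.Ψ₃.eval (q - W.b₂ / 12) = 0) :
    padicValRat 3 (W.Ψ₂Sq.eval (q - W.b₂ / 12)) = 0 ∨ padicValRat 3 (W.Ψ₂Sq.eval (q - W.b₂ / 12)) = 3 := by
  haveI : Fact (Nat.Prime 3) := ⟨Nat.prime_three⟩
  rcases veluD₀_dichotomy_of_IstarZero_three W h9 h27 hΔ6 q hq with ⟨h0, -⟩ | hD3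
  · exact Or.inl h0
  · right
    obtain ⟨W', k, hE', hM', hiso, hk, hk0, -, -, hbook⟩ := exists_isIsogenous_dvd_three_velu_three W q hq
    haveI := hE'; haveI := hM'
    have hb := hbook 3
    rw [hΔ6] at hb
    push_cast at hb
    have hkv : (0 : ℤ) ≤ padicValInt 3 k := Nat.cast_nonneg _
    have hδ' := three_le_padicValInt_minimalDiscriminantInt_of_hasAdditiveReductionAt_three W'
      (hasAdditiveReductionAt_placeOf_three_of_isIsogenous (hasAdditiveReductionAt_placeOf_three_of_nine_dvd W h9) hiso)
    omega

/-- **E-an-109, even branch, UNCONDITIONAL:** on tame `I₀*` a rational `3`-line with `ord₃ D₀` even has `ord₃ D₀ = 0`, an ISOGENOUS globally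
minimal `u = 3` carrier, and no isogenous `u = 1` carrier. [cite: SilvermanATAEC1994, IV.9.4 Table 4.1] [cite: DokchitserDokchitser2015LocalInvariants, Table 1] -/
theorem IstarZero_velu_three_of_even' (W : WeierstrassCurve ℚ) [W.IsElliptic] [W.IsGloballyMinimal]
    (h9 : 3 ^ 2 ∣ W.conductorNorm ℤ) (h27 : ¬ 3 ^ 3 ∣ W.conductorNorm ℤ) (hΔ6 : padicValInt 3 W.minimalDiscriminantInt = 6)
    (q : ℚ) (hq : W.Ψ₃.eval (q - W.b₂ / 12) = 0) (heven : Even (padicValRat 3 (W.Ψ₂Sq.eval (q - W.b₂ / 12)))) :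
    padicValRat 3 (W.Ψ₂Sq.eval (q - W.b₂ / 12)) = 0 ∧
      (∃ (W' : WeierstrassCurve ℚ) (_ : W'.IsElliptic) (_ : W'.IsGloballyMinimal), IsIsogenous W W' ∧
        (3 : ℚ) ^ 4 * W'.c₄ = 1440 * q ^ 2 - 9 * W.c₄ ∧
        (3 : ℚ) ^ 6 * W'.c₆ = 60480 * q ^ 3 - 756 * W.c₄ * q - 27 * W.c₆) ∧
      ¬ ∃ (W' : WeierstrassCurve ℚ) (_ : W'.IsElliptic) (_ : W'.IsGloballyMinimal), IsIsogenous W W' ∧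
        W'.c₄ = 1440 * q ^ 2 - 9 * W.c₄ ∧ W'.c₆ = 60480 * q ^ 3 - 756 * W.c₄ * q - 27 * W.c₆ := by
  haveI : Fact (Nat.Prime 3) := ⟨Nat.prime_three⟩
  have haW := hasAdditiveReductionAt_placeOf_three_of_nine_dvd W h9
  have hD0 : padicValRat 3 (W.Ψ₂Sq.eval (q - W.b₂ / 12)) = 0 := by
    rcases IstarZero_padicValRat_D₀_eq_zero_or_three W h9 h27 hΔ6 q hq with h | h
    · exact h
    · exfalso; rw [h] at heven; exact (Int.not_even_iff_odd.mpr (by decide)) heven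
  have hA : 1440 * q ^ 2 - 9 * W.c₄ = 0 ∨ 4 ≤ padicValRat 3 (1440 * q ^ 2 - 9 * W.c₄) := by
    rcases veluD₀_dichotomy_of_IstarZero_three W h9 h27 hΔ6 q hq with ⟨-, hA⟩ | hD3
    · exact hA
    · omega
  -- no ISOGENOUS `u = 1` carrier: it would be additive at `3` with `ord₃ Δ_min = 18`, i.e. `I₁₂*`, `ord₃ j = −12`
  have hnoMin : ¬ ∃ (W' : WeierstrassCurve ℚ) (_ : W'.IsElliptic) (_ : W'.IsGloballyMinimal), IsIsogenous W W' ∧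
      W'.c₄ = 1440 * q ^ 2 - 9 * W.c₄ ∧ W'.c₆ = 60480 * q ^ 3 - 756 * W.c₄ * q - 27 * W.c₆ := by
    rintro ⟨W', hE', hM', hiso, hc4, hc6⟩
    have hb := padicValRat_velu_three_Δ 3 W q hq W' hc4 hc6
    rw [hD0, ← cast_minimalDiscriminantInt W', ← cast_minimalDiscriminantInt W, padicValRat.of_int, padicValRat.of_int, hΔ6] at hb
    push_cast at hb
    have hδ' : padicValInt 3 W'.minimalDiscriminantInt = 18 := by omega
    have hj := padicValRat_three_j_of_additive_of_eq_eighteen W' (hasAdditiveReductionAt_placeOf_three_of_isIsogenous haW hiso) hδ'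
    rcases hA with hA0 | hA4
    · have hj0 : W'.j = 0 := by rw [WeierstrassCurve.j, hc4, hA0]; ring
      rw [hj0, padicValRat.zero] at hj
      norm_num at hj
    · have hc₄ne : W'.c₄ ≠ 0 := by
        intro h0; rw [← hc4, h0, padicValRat.zero] at hA4; norm_num at hA4
      rw [padicValRat_three_j_eq W' hc₄ne, hc4, ← cast_minimalDiscriminantInt W', padicValRat.of_int, hδ'] at hj
      push_cast at hj
      omega
  refine ⟨hD0, ?_, hnoMin⟩
  obtain ⟨W', k, hE', hM', hiso, hk, hk0, h4', h6', -⟩ := exists_isIsogenous_dvd_three_velu_three W q hq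
  haveI := hE'; haveI := hM'
  rcases eq_or_eq_of_int_dvd_three hk with hk1 | hk3
  · exfalso
    have hk4 : (k : ℚ) ^ 4 = 1 := by rcases hk1 with rfl | rfl <;> norm_num
    have hk6 : (k : ℚ) ^ 6 = 1 := by rcases hk1 with rfl | rfl <;> norm_num
    rw [hk4, one_mul] at h4'
    rw [hk6, one_mul] at h6'
    exact hnoMin ⟨W', hE', hM', hiso, h4', h6'⟩
  · have hk4 : (k : ℚ) ^ 4 = 3 ^ 4 := by rcases hk3 with rfl | rfl <;> norm_num
    have hk6 : (k : ℚ) ^ 6 = 3 ^ 6 := by rcases hk3 with rfl | rfl <;> norm_num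
    rw [hk4] at h4'
    rw [hk6] at h6'
    exact ⟨W', hE', hM', hiso, h4', h6'⟩

/-! ### §4 The tame Néron-scalar table at `3`, unconditional -/

/-- **The tame Néron-scalar table at `3` for rational `3`-lines (E-an-107 / 108 / 109), UNCONDITIONAL.**  `W` globally minimal, `9 ∥ N`,
`ord₃ j ≥ 0`, `q` a rational `3`-line, `(A, B)` the `u = 1` Vélu pair, `D₀ = Ψ₂²(q − b₂/12)`:
`III` (`ord₃ Δ_min = 3`): isogenous globally minimal carrier of `(A, B)` of type `III*`, no carrier of `(3⁻⁴A, 3⁻⁶B)`;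
`III*` (`9`): isogenous carrier of `(3⁻⁴A, 3⁻⁶B)` of type `III`, no carrier of `(A, B)`;
`I₀*` (`6`): `ord₃ D₀ ∈ {0, 3}`; `3` ⟹ isogenous `I₀*` carrier of `(A, B)`, no thrice carrier; `0` ⟹ isogenous thrice carrier, no isogenous
carrier of `(A, B)`. [cite: SilvermanATAEC1994, IV.9.4 Table 4.1] [cite: DokchitserDokchitser2015LocalInvariants, Table 1] -/
theorem tameThree_neronScalar_table (W : WeierstrassCurve ℚ) [W.IsElliptic] [W.IsGloballyMinimal]
    (h9 : 3 ^ 2 ∣ W.conductorNorm ℤ) (h27 : ¬ 3 ^ 3 ∣ W.conductorNorm ℤ) (hj : 0 ≤ padicValRat 3 W.j)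
    (q : ℚ) (hq : W.Ψ₃.eval (q - W.b₂ / 12) = 0) :
    (padicValInt 3 W.minimalDiscriminantInt = 3 →
      (∃ (W' : WeierstrassCurve ℚ) (_ : W'.IsElliptic) (_ : W'.IsGloballyMinimal), IsIsogenous W W' ∧
        W'.c₄ = 1440 * q ^ 2 - 9 * W.c₄ ∧ W'.c₆ = 60480 * q ^ 3 - 756 * W.c₄ * q - 27 * W.c₆ ∧
        padicValInt 3 W'.minimalDiscriminantInt = 9) ∧
      ¬ ∃ W' : WeierstrassCurve ℚ, W'.IsElliptic ∧ W'.IsGloballyMinimal ∧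
        (3 : ℚ) ^ 4 * W'.c₄ = 1440 * q ^ 2 - 9 * W.c₄ ∧
        (3 : ℚ) ^ 6 * W'.c₆ = 60480 * q ^ 3 - 756 * W.c₄ * q - 27 * W.c₆) ∧
    (padicValInt 3 W.minimalDiscriminantInt = 9 →
      (∃ (W' : WeierstrassCurve ℚ) (_ : W'.IsElliptic) (_ : W'.IsGloballyMinimal), IsIsogenous W W' ∧
        (3 : ℚ) ^ 4 * W'.c₄ = 1440 * q ^ 2 - 9 * W.c₄ ∧
        (3 : ℚ) ^ 6 * W'.c₆ = 60480 * q ^ 3 - 756 * W.c₄ * q - 27 * W.c₆ ∧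
        padicValInt 3 W'.minimalDiscriminantInt = 3) ∧
      ¬ ∃ W' : WeierstrassCurve ℚ, W'.IsElliptic ∧ W'.IsGloballyMinimal ∧
        W'.c₄ = 1440 * q ^ 2 - 9 * W.c₄ ∧ W'.c₆ = 60480 * q ^ 3 - 756 * W.c₄ * q - 27 * W.c₆) ∧
    (padicValInt 3 W.minimalDiscriminantInt = 6 →
      (padicValRat 3 (W.Ψ₂Sq.eval (q - W.b₂ / 12)) = 0 ∨ padicValRat 3 (W.Ψ₂Sq.eval (q - W.b₂ / 12)) = 3) ∧
      (padicValRat 3 (W.Ψ₂Sq.eval (q - W.b₂ / 12)) = 3 →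
        (∃ (W' : WeierstrassCurve ℚ) (_ : W'.IsElliptic) (_ : W'.IsGloballyMinimal), IsIsogenous W W' ∧
          W'.c₄ = 1440 * q ^ 2 - 9 * W.c₄ ∧ W'.c₆ = 60480 * q ^ 3 - 756 * W.c₄ * q - 27 * W.c₆ ∧
          padicValInt 3 W'.minimalDiscriminantInt = 6) ∧
        ¬ ∃ W' : WeierstrassCurve ℚ, W'.IsElliptic ∧ W'.IsGloballyMinimal ∧
          (3 : ℚ) ^ 4 * W'.c₄ = 1440 * q ^ 2 - 9 * W.c₄ ∧
          (3 : ℚ) ^ 6 * W'.c₆ = 60480 * q ^ 3 - 756 * W.c₄ * q - 27 * W.c₆) ∧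
      (padicValRat 3 (W.Ψ₂Sq.eval (q - W.b₂ / 12)) = 0 →
        (∃ (W' : WeierstrassCurve ℚ) (_ : W'.IsElliptic) (_ : W'.IsGloballyMinimal), IsIsogenous W W' ∧
          (3 : ℚ) ^ 4 * W'.c₄ = 1440 * q ^ 2 - 9 * W.c₄ ∧
          (3 : ℚ) ^ 6 * W'.c₆ = 60480 * q ^ 3 - 756 * W.c₄ * q - 27 * W.c₆) ∧
        ¬ ∃ (W' : WeierstrassCurve ℚ) (_ : W'.IsElliptic) (_ : W'.IsGloballyMinimal), IsIsogenous W W' ∧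
          W'.c₄ = 1440 * q ^ 2 - 9 * W.c₄ ∧ W'.c₆ = 60480 * q ^ 3 - 756 * W.c₄ * q - 27 * W.c₆)) := by
  refine ⟨fun h3 ↦ ⟨exists_isIsogenous_velu_three_of_III W h9 h27 h3 q hq,
      not_exists_isGloballyMinimal_three_velu_three_of_III W h9 h27 h3 q hq⟩,
    fun h9Δ ↦ ⟨exists_isIsogenous_three_velu_three_of_IIIstar W h9 h27 h9Δ hj q hq,
      not_exists_isGloballyMinimal_velu_three_of_IIIstar W h9 h27 h9Δ hj q hq⟩,
    fun h6 ↦ ⟨IstarZero_padicValRat_D₀_eq_zero_or_three W h9 h27 h6 q hq, fun hD3 ↦ ?_, fun hD0 ↦ ?_⟩⟩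
  · have hodd : Odd (padicValRat 3 (W.Ψ₂Sq.eval (q - W.b₂ / 12))) := ⟨1, by rw [hD3]; norm_num⟩
    obtain ⟨-, hex, hno⟩ := IstarZero_velu_three_of_odd W h9 h27 h6 q hq hodd
    exact ⟨hex, hno⟩
  · have heven : Even (padicValRat 3 (W.Ψ₂Sq.eval (q - W.b₂ / 12))) := ⟨0, by rw [hD0]; norm_num⟩
    obtain ⟨-, hex, hno⟩ := IstarZero_velu_three_of_even' W h9 h27 h6 q hq heven
    exact ⟨hex, hno⟩

end Summit.BirchSwinnertonDyer.BirchSwinnertonDyer.Theorems.ManinLocalTwoThree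

end
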